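import Literature.MathematicalPhysics.QuantumFieldTheory.Balaban1983to89.B1Eq324BenfattoSect5Eq515
import HarnessLib

/-!
# `Balaban1983to89.B1Eq324BenfattoClassCrossRowMass` — [BenfattoEtAl1978] §5 (5.7)–(5.8), (5.13) p. 154–155 for the class of
# [Balaban1985BackgroundPropagators] Sect. E p. 428: the CROSS-ROW MASS of a class precision across the pavement «boxes `□′ ∪ Γ₂(□)` +
# far region» separated by the corridor network `Γ₁`, in the Combes–Thomas (cosh row-defect) currency, with its |B|·L^d-extensive budget, PROVED

statement-level skeleton of published theorems with citation tags; proofs where landed; nothing here is a claim about the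
Yang–Mills mass gap

WHY THIS MODULE (cell `pub-ymgap`, width seat `dag-n08-w5`; node N08 [Balaban1985UV3]; the [BenfattoEtAl1978] source chain behind the
(α)-row `h324`).  The tree's class substitute for print's exact Markov factorisation (5.13) — seat n08-b's
`…ClassDecouplingExtensive.decoupling_extensive`, seat n08-d's field editions `…KernelComparisonBoxes` §3 / `…KernelComparisonBounded` §3
(and their Bochner twins `…KernelComparisonBochner`) — all take as HYPOTHESES the cross-row sums of the precision across the chosen
partition of `Λ ∖ Γ`: `hr : Σ_{π y′ ≠ π y}|A_{yy′}| ≤ r_y`, `r_y ≤ r_max < γ`, with the prefactor `e^{±ρ}`, `ρ = (Σ_y r_y)/(γ − r_max)`.  The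
only supplier of such a row in the tree is `…ClassDecoupling.cross_rowSum_le_exp`, in the `e^{κ′·dist}`-weighted currency and with a UNIFORM
separation; the class itself is stated in the cosh row-defect currency of `…ClassAppendixC` (`Σ_{e′}|A e e′|(cosh(κ·dist e e′) − 1) ≤ J`), and
the partition the §5 chain uses is print's: after conditioning on `z_{Γ₁}`, `Γ₁ = ⋃_{□∈B} Γ₁(□)` ((5.8)), the remaining sites of `Λ` split
into the regions `□′ ∪ Γ₂(□) = shrink L m w` (`m ∈ B`) and the far region `out L B` (the tesserae not in `B`).  This file supplies `r`
for THAT partition from the class hypothesis alone: every pair of sites in different parts is `≥ w` apart in the cube distance (the corridor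
`Γ₁(□)` of width `w` lies between `shrink L m w` and everything outside `□_m`), and a far site `y` is moreover `≥ d(Δ_y, ⋃_{m∈B} □_m)` away
from every box part; hence `r_y := J/(cosh(κ·max(w, d(Δ_y, ⋃□))) − 1)` works, `r_max = J/(cosh κw − 1)`, and — the point of the
position dependence — `Σ_{y∈Λ∖Γ₁} r_y ≤ C(κ,w,d)·J·|B|·L^d·e^{−κw/2}` is extensive in the NUMBER OF BOXES, not in `|Λ|`, and exponentially
small in the corridor width (seat n08-d gen 12's design note: «for ρ and T to be |I|-extensive (not |Λ|-extensive) the partition must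
decouple only near I: one giant far part + boxes near I»).

WHAT IS PROVED (standard axioms; no `sorry`; no definition).
* §1 COSH CURRENCY, KERNEL-GENERIC (finite `m`, labelling `π : m → σ`, weight `dist`, `κ ≥ 0`, row defect `J`):
  `exp_mul_le_cosh_sub_one` (via the kernel `cosh t − 1 = e^t(1 − e^{−t})²/2`), `inv_cosh_sub_one_le_exp`
  (`t ≥ t₀ > 0 ⇒ (cosh t − 1)⁻¹ ≤ 2(1 − e^{−t₀})⁻²e^{−t}`), `rowDefect_nonneg` (`0 ≤ J`), ★ `cross_rowSum_le_div_of_rowDefect`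
  (`π y ≠ π y′ → w ≤ dist y y′`, `κw > 0` ⇒ `Σ_{y′}(if π y = π y′ then 0 else |B y y′|) ≤ J/(cosh(κw) − 1)`), `div_cosh_sub_one_anti`
  (monotonicity of `w ↦ J/(cosh(κw) − 1)`), `cross_rowSum_le_exp_of_rowDefect` (the same `≤ 2J(1 − e^{−κw₀})⁻²·e^{−κw}` for `w₀ ≤ w`).
* §2 THE (5.7)–(5.8) PAVEMENT (`Site d`, `cubeDist`, `0 < L`, family `B`, `Γ₁ := corridors L w B`): `distToRegion_le_cubeDist`,
  `le_cubeDist_of_mem_shrink_of_mem_shrink` (`m ≠ m′`), `le_cubeDist_of_mem_shrink_of_mem_out`, `max_le_cubeDist_of_mem_out_of_mem_shrink`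
  (far site vs box part: `max(w, d(Δ_y, ⋃□)) ≤ cubeDist y y′`), `distToRegion_biUnion_box_eq_zero_of_mem_shrink`, `max_le_cubeDist_of_ne(_of_labels)`;
  and, for `A` on `Λ` with cosh row defect `J` at rate `κ > 0` w.r.t. `cubeDist`: ★★ `cross_rowSum_le_of_class_pavement` — the row `hr` of the
  decoupling theorems for the labelling of record `π : ↥(Λ ∖ Γ₁) → Option ↥B`, `π y = some m ↔ y ∈ shrink L m w` (seat n08-d's displayed row),
  with the EXPLICIT `r y := J/(cosh(κ·max(w, d(Δ_y, ⋃_{m∈B} □_m))) − 1)` (and `…_of_labels`: the same for ANY labelling constant on each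
  `shrink L m w` and on `out L B`); `crossRow_le_rmax` (`r y ≤ J/(cosh(κw) − 1)` — the `hrmax` row).
* §3 THE BUDGET: ★★ `sum_crossRow_le_of_class_pavement` — for `B` non-empty,
  `Σ_{y∈Λ∖Γ₁} r_y ≤ (2J/(1 − e^{−κw})²)·e^{−κw/2}·(|B|·L^d)·V_d(κ/2)`, `V_d(c) = (2e^{c/√d}/(1 − e^{−c/√d}))^d` the growth constant of
  `…ConnLength.sum_exp_neg_mul_cubeDist_le` — |B|·L^d-EXTENSIVE, independent of `|Λ|`, exponentially small in `w`.
HONEST SCOPE.  Lattice geometry of print's pavement plus one cosh inequality; the class and the substitute for (5.13) are OURS, not print;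
nothing of [Balaban1985UV3] / [Balaban1985UV2] is asserted; no generalised Basic Lemma is stated; the §5-side port is not begun here;
count-neutral for N08; nothing about d = 4, the continuum, OS axioms, a mass gap or the Clay problem.
-/

noncomputable section

open Finset
open scoped BigOperators

namespace Literature.MathematicalPhysics.QuantumFieldTheory.Balaban1983to89.B1Eq324BenfattoClassCrossRowMass

open Literature.MathematicalPhysics.QuantumFieldTheory.Balaban1983to89.B1Eq324BenfattoLemma
open Literature.MathematicalPhysics.QuantumFieldTheory.Balaban1983to89.B1Eq324BenfattoAppendixA (cubeDist_nonneg distToRegion_nonneg)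
open Literature.MathematicalPhysics.QuantumFieldTheory.Balaban1983to89.B1Eq324BenfattoConnLength (cubeDist_comm sum_exp_neg_mul_cubeDist_le)
open Literature.MathematicalPhysics.QuantumFieldTheory.Balaban1983to89.B1Eq324BenfattoSect5Boxes
open Literature.MathematicalPhysics.QuantumFieldTheory.Balaban1983to89.B1Eq324BenfattoSect5Eq511 (le_cubeDist_of_mem_shrink_of_not_mem_box)
open Literature.MathematicalPhysics.QuantumFieldTheory.Balaban1983to89.B1Eq324BenfattoSect5Eq524 (card_shrink_le)
open Literature.MathematicalPhysics.QuantumFieldTheory.Balaban1983to89.B1Eq324BenfattoSect5SlotMoments (distToRegion_eq_zero_of_mem)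
open Literature.MathematicalPhysics.QuantumFieldTheory.Balaban1983to89.B1Eq324BenfattoSect5Eq515 (out mem_corridors_or_shrink_or_out)

variable {d : ℕ}

/-! ## §1  Cosh currency: the cross-row sum of a row-defect-bounded kernel across separated parts -/

section Cosh

/-- kernel: `cosh t − 1 = e^{t}(1 − e^{−t})²/2`. [folklore] -/
private theorem cosh_sub_one_eq_exp_mul (t : ℝ) : Real.cosh t - 1 = Real.exp t * (1 - Real.exp (-t)) ^ 2 / 2 := by
  rw [Real.cosh_eq]
  have h : Real.exp t * Real.exp (-t) = 1 := by rw [← Real.exp_add, add_neg_cancel, Real.exp_zero]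
  linear_combination ((2 - Real.exp (-t)) / 2) * h

/-- **For `t ≥ t₀ ≥ 0`: `(1 − e^{−t₀})²/2 · e^{t} ≤ cosh t − 1`.** [cite: BenfattoEtAl1978, §5 (5.13) p.155 (class substitute; ours)] -/
theorem exp_mul_le_cosh_sub_one {t₀ t : ℝ} (ht₀ : 0 ≤ t₀) (h : t₀ ≤ t) :
    (1 - Real.exp (-t₀)) ^ 2 / 2 * Real.exp t ≤ Real.cosh t - 1 := by
  rw [cosh_sub_one_eq_exp_mul]
  have h1 : 1 - Real.exp (-t₀) ≤ 1 - Real.exp (-t) := by linarith [Real.exp_le_exp.mpr (neg_le_neg h)]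
  have h0 : 0 ≤ 1 - Real.exp (-t₀) := by linarith [Real.exp_le_one_iff.mpr (neg_nonpos.mpr ht₀)]
  have h2 : (1 - Real.exp (-t₀)) ^ 2 ≤ (1 - Real.exp (-t)) ^ 2 := pow_le_pow_left₀ h0 h1 2
  have h3 := Real.exp_pos t
  nlinarith

/-- **For `t ≥ t₀ > 0`: `(cosh t − 1)⁻¹ ≤ 2(1 − e^{−t₀})⁻²·e^{−t}`** — the exponential reading of the cosh row-defect currency.
[cite: BenfattoEtAl1978, §5 (5.13) p.155 (class substitute; ours)] -/
theorem inv_cosh_sub_one_le_exp {t₀ t : ℝ} (ht₀ : 0 < t₀) (h : t₀ ≤ t) :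
    (Real.cosh t - 1)⁻¹ ≤ 2 / (1 - Real.exp (-t₀)) ^ 2 * Real.exp (-t) := by
  have h0 : 0 < 1 - Real.exp (-t₀) := by linarith [Real.exp_lt_one_iff.mpr (neg_neg_of_pos ht₀)]
  have hc0 : 0 < (1 - Real.exp (-t₀)) ^ 2 / 2 * Real.exp t := by positivity
  calc (Real.cosh t - 1)⁻¹ ≤ ((1 - Real.exp (-t₀)) ^ 2 / 2 * Real.exp t)⁻¹ := inv_anti₀ hc0 (exp_mul_le_cosh_sub_one ht₀.le h)
    _ = 2 / (1 - Real.exp (-t₀)) ^ 2 * Real.exp (-t) := by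
        rw [Real.exp_neg t, mul_inv, inv_div]

variable {m : Type*} [Fintype m] {σ : Type*} [DecidableEq σ]

/-- **A row defect is non-negative** (so `0 ≤ J` whenever the index set is inhabited). [cite: BenfattoEtAl1978, Appendix C (C.2) p.164 (class form; ours)] -/
theorem rowDefect_nonneg {B : Matrix m m ℝ} {dist : m → m → ℝ} {κ J : ℝ}
    (hJ : ∀ y, ∑ y', |B y y'| * (Real.cosh (κ * dist y y') - 1) ≤ J) (y : m) : 0 ≤ J :=
  le_trans (Finset.sum_nonneg fun y' _ => mul_nonneg (abs_nonneg _) (by linarith [Real.one_le_cosh (κ * dist y y')])) (hJ y)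

/-- **THE CROSS-ROW SUM IN THE COSH CURRENCY.**  If the kernel `B` has Combes–Thomas row defect `Σ_{y′}|B y y′|(cosh(κ·dist y y′) − 1) ≤ J`
(`κ ≥ 0`) and every site `y′` of a part different from that of `y` is at `dist y y′ ≥ w` with `κw > 0`, then the cross-row sum at `y` is at most
`J/(cosh(κw) − 1)`: the weights `cosh(κ·dist) − 1 ≥ cosh(κw) − 1 > 0` dominate the indicator of the cross part.
[cite: BenfattoEtAl1978, §5 (5.13) p.155 (class substitute; ours); Balaban1985BackgroundPropagators, Sect. E p.428] -/
theorem cross_rowSum_le_div_of_rowDefect {B : Matrix m m ℝ} (π : m → σ) {dist : m → m → ℝ} {κ J : ℝ} (hκ : 0 ≤ κ)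
    (hJ : ∀ y, ∑ y', |B y y'| * (Real.cosh (κ * dist y y') - 1) ≤ J)
    (y : m) {w : ℝ} (hw : 0 < κ * w) (hsep : ∀ y', π y ≠ π y' → w ≤ dist y y') :
    ∑ y', (if π y = π y' then (0 : ℝ) else |B y y'|) ≤ J / (Real.cosh (κ * w) - 1) := by
  have hc : 0 < Real.cosh (κ * w) - 1 := by linarith [Real.one_lt_cosh.mpr hw.ne']
  rw [le_div_iff₀ hc, Finset.sum_mul]
  refine le_trans (Finset.sum_le_sum fun y' _ => ?_) (hJ y)
  by_cases h : π y = π y'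
  · rw [if_pos h, zero_mul]
    exact mul_nonneg (abs_nonneg _) (by linarith [Real.one_le_cosh (κ * dist y y')])
  · rw [if_neg h]
    refine mul_le_mul_of_nonneg_left ?_ (abs_nonneg _)
    have hle : κ * w ≤ κ * dist y y' := mul_le_mul_of_nonneg_left (hsep y' h) hκ
    have hcosh : Real.cosh (κ * w) ≤ Real.cosh (κ * dist y y') := Real.cosh_le_cosh.mpr (by
      rw [abs_of_pos hw, abs_of_pos (lt_of_lt_of_le hw hle)]; exact hle)
    linarith

omit [Fintype m] [DecidableEq σ] in
/-- **`w ↦ J/(cosh(κw) − 1)` is antitone on `κw > 0`** (for `J ≥ 0`). [cite: BenfattoEtAl1978, §5 (5.13) p.155 (class substitute; ours)] -/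
theorem div_cosh_sub_one_anti {κ J w w' : ℝ} (hJ : 0 ≤ J) (hκ : 0 ≤ κ) (hw : 0 < κ * w) (hww' : w ≤ w') :
    J / (Real.cosh (κ * w') - 1) ≤ J / (Real.cosh (κ * w) - 1) := by
  have hc : 0 < Real.cosh (κ * w) - 1 := by linarith [Real.one_lt_cosh.mpr hw.ne']
  have hle : κ * w ≤ κ * w' := mul_le_mul_of_nonneg_left hww' hκ
  have hcosh : Real.cosh (κ * w) ≤ Real.cosh (κ * w') := Real.cosh_le_cosh.mpr (by
    rw [abs_of_pos hw, abs_of_pos (lt_of_lt_of_le hw hle)]; exact hle)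
  exact div_le_div_of_nonneg_left hJ hc (by linarith)

/-- **The cross-row sum in exponential form**: under the hypotheses of `cross_rowSum_le_div_of_rowDefect` with `κ > 0` and `0 < w₀ ≤ w`,
`Σ_{π y′ ≠ π y}|B y y′| ≤ (2J/(1 − e^{−κw₀})²)·e^{−κw}` — print's «`M₂e^{−ϰ′·(separation)}`» shape for the class.
[cite: BenfattoEtAl1978, §5 (5.13) p.155 (class substitute; ours)] -/
theorem cross_rowSum_le_exp_of_rowDefect {B : Matrix m m ℝ} (π : m → σ) {dist : m → m → ℝ} {κ J : ℝ} (hκ : 0 < κ)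
    (hJ : ∀ y, ∑ y', |B y y'| * (Real.cosh (κ * dist y y') - 1) ≤ J)
    (y : m) {w₀ w : ℝ} (hw₀ : 0 < w₀) (hw : w₀ ≤ w) (hsep : ∀ y', π y ≠ π y' → w ≤ dist y y') :
    ∑ y', (if π y = π y' then (0 : ℝ) else |B y y'|) ≤ 2 * J / (1 - Real.exp (-(κ * w₀))) ^ 2 * Real.exp (-(κ * w)) := by
  have hJ0 : 0 ≤ J := rowDefect_nonneg hJ y
  have hκw : 0 < κ * w := mul_pos hκ (lt_of_lt_of_le hw₀ hw)
  have h1 := cross_rowSum_le_div_of_rowDefect π hκ.le hJ y hκw hsep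
  have h2 : (Real.cosh (κ * w) - 1)⁻¹ ≤ 2 / (1 - Real.exp (-(κ * w₀))) ^ 2 * Real.exp (-(κ * w)) :=
    inv_cosh_sub_one_le_exp (mul_pos hκ hw₀) (mul_le_mul_of_nonneg_left hw hκ.le)
  calc ∑ y', (if π y = π y' then (0 : ℝ) else |B y y'|) ≤ J / (Real.cosh (κ * w) - 1) := h1
    _ = J * (Real.cosh (κ * w) - 1)⁻¹ := div_eq_mul_inv _ _
    _ ≤ J * (2 / (1 - Real.exp (-(κ * w₀))) ^ 2 * Real.exp (-(κ * w))) := mul_le_mul_of_nonneg_left h2 hJ0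
    _ = 2 * J / (1 - Real.exp (-(κ * w₀))) ^ 2 * Real.exp (-(κ * w)) := by ring

end Cosh

/-! ## §2  The (5.7)–(5.8) pavement: separation of the parts and the row `hr` for the class -/

section Pavement

/-- `d(Δ_y, I) ≤ cubeDist y x` for every `x ∈ I`. [cite: BenfattoEtAl1978, after (2.3) p.146] -/
theorem distToRegion_le_cubeDist {I : Finset (B1Eq324BenfattoLemma.Site d)} {x : B1Eq324BenfattoLemma.Site d} (hx : x ∈ I)
    (y : B1Eq324BenfattoLemma.Site d) : distToRegion I y ≤ cubeDist y x := by
  rw [distToRegion, dif_pos ⟨x, hx⟩]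
  exact Finset.inf'_le _ hx

/-- **Sites of `shrink w` of two distinct tesserae are `≥ w` apart** (each lies outside the other's tessera, across its corridor `Γ₁(□)`).
[cite: BenfattoEtAl1978, (5.7) p.154, (5.13) p.155] -/
theorem le_cubeDist_of_mem_shrink_of_mem_shrink {L w : ℕ} (hL : 0 < L) {m₁ m₂ x y : B1Eq324BenfattoLemma.Site d} (hne : m₁ ≠ m₂)
    (hx : x ∈ shrink L m₁ w) (hy : y ∈ shrink L m₂ w) : (w : ℝ) ≤ cubeDist x y :=
  le_cubeDist_of_mem_shrink_of_not_mem_box hx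
    (Finset.disjoint_right.mp (disjoint_box hL hne) (shrink_subset_box L m₂ w hy))

/-- **A site of `shrink w` of a tessera of `B` and a site of the far region are `≥ w` apart.** [cite: BenfattoEtAl1978, (5.7) p.154, (5.13) p.155] -/
theorem le_cubeDist_of_mem_shrink_of_mem_out {L w : ℕ} {B : Finset (B1Eq324BenfattoLemma.Site d)} {m₁ x y : B1Eq324BenfattoLemma.Site d}
    (hm : m₁ ∈ B) (hx : x ∈ shrink L m₁ w) (hy : y ∈ out L B) : (w : ℝ) ≤ cubeDist x y :=
  le_cubeDist_of_mem_shrink_of_not_mem_box hx (hy m₁ hm)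

/-- **A far site and a site of `shrink w` of a tessera of `B` are `≥ max(w, d(Δ_y, ⋃_{m∈B} □_m))` apart.**
[cite: BenfattoEtAl1978, (5.7) p.154, (5.13) p.155] -/
theorem max_le_cubeDist_of_mem_out_of_mem_shrink {L w : ℕ} {B : Finset (B1Eq324BenfattoLemma.Site d)}
    {m₁ x y : B1Eq324BenfattoLemma.Site d} (hm : m₁ ∈ B) (hx : x ∈ out L B) (hy : y ∈ shrink L m₁ w) :
    max (w : ℝ) (distToRegion (B.biUnion (box L)) x) ≤ cubeDist x y := by
  refine max_le ?_ ?_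
  · rw [cubeDist_comm]
    exact le_cubeDist_of_mem_shrink_of_mem_out hm hy hx
  · exact distToRegion_le_cubeDist (Finset.mem_biUnion.mpr ⟨m₁, hm, shrink_subset_box L m₁ w hy⟩) x

/-- **On the box parts the distance to the pavement vanishes**: `d(Δ_x, ⋃_{m∈B} □_m) = 0` for `x ∈ shrink L m₁ w`, `m₁ ∈ B` — so the
position-dependent separation `max(w, d(Δ_x, ⋃□))` reads `w` there. [cite: BenfattoEtAl1978, (5.7) p.154] -/
theorem distToRegion_biUnion_box_eq_zero_of_mem_shrink {L w : ℕ} {B : Finset (B1Eq324BenfattoLemma.Site d)}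
    {m₁ x : B1Eq324BenfattoLemma.Site d} (hm : m₁ ∈ B) (hx : x ∈ shrink L m₁ w) :
    distToRegion (B.biUnion (box L)) x = 0 :=
  distToRegion_eq_zero_of_mem (Finset.mem_biUnion.mpr ⟨m₁, hm, shrink_subset_box L m₁ w hx⟩)

/-- **Every pair of sites of `Λ ∖ Γ₁` in different parts is `≥ max(w, d(Δ_y, ⋃□))` apart**, for any labelling `π` of `↥(Λ ∖ Γ₁)` constant on
each `shrink L m w` (`m ∈ B`) and on the far region (the cover `…Sect5Eq515.mem_corridors_or_shrink_or_out` puts every site of `Λ ∖ Γ₁` in one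
of these). [cite: BenfattoEtAl1978, (5.7)–(5.8) p.154–155, (5.13) p.155] -/
theorem max_le_cubeDist_of_ne_of_labels {Λ : Finset (B1Eq324BenfattoLemma.Site d)} {L w : ℕ} (hL : 0 < L)
    (B : Finset (B1Eq324BenfattoLemma.Site d)) {σ : Type*} (π : ↥(Λ \ corridors L w B) → σ)
    (hπbox : ∀ m₁ ∈ B, ∀ y y' : ↥(Λ \ corridors L w B),
      (y : B1Eq324BenfattoLemma.Site d) ∈ shrink L m₁ w → (y' : B1Eq324BenfattoLemma.Site d) ∈ shrink L m₁ w → π y = π y')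
    (hπout : ∀ y y' : ↥(Λ \ corridors L w B),
      (y : B1Eq324BenfattoLemma.Site d) ∈ out L B → (y' : B1Eq324BenfattoLemma.Site d) ∈ out L B → π y = π y')
    (y y' : ↥(Λ \ corridors L w B)) (hne : π y ≠ π y') :
    max (w : ℝ) (distToRegion (B.biUnion (box L)) y) ≤
      cubeDist (y : B1Eq324BenfattoLemma.Site d) (y' : B1Eq324BenfattoLemma.Site d) := by
  have hcov : ∀ z : ↥(Λ \ corridors L w B),
      (∃ m₁ ∈ B, (z : B1Eq324BenfattoLemma.Site d) ∈ shrink L m₁ w) ∨ (z : B1Eq324BenfattoLemma.Site d) ∈ out L B :=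
    fun z => (mem_corridors_or_shrink_or_out L w B z).resolve_left (Finset.mem_sdiff.mp z.2).2
  rcases hcov y with ⟨m₁, hm₁, hym⟩ | hyo
  · rw [distToRegion_biUnion_box_eq_zero_of_mem_shrink hm₁ hym, max_eq_left (Nat.cast_nonneg w)]
    rcases hcov y' with ⟨m₂, hm₂, hy'm⟩ | hy'o
    · have hmm : m₁ ≠ m₂ := by
        intro h
        subst h
        exact hne (hπbox m₁ hm₁ y y' hym hy'm)
      exact le_cubeDist_of_mem_shrink_of_mem_shrink hL hmm hym hy'm
    · exact le_cubeDist_of_mem_shrink_of_mem_out hm₁ hym hy'o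
  · rcases hcov y' with ⟨m₂, hm₂, hy'm⟩ | hy'o
    · exact max_le_cubeDist_of_mem_out_of_mem_shrink hm₂ hyo hy'm
    · exact absurd (hπout y y' hyo hy'o) hne


/-- kernel: a `some`-iff labelling by the boxes of `B` is constant on each `shrink L m w`. [folklore] -/
private theorem labels_const_box {Λ : Finset (B1Eq324BenfattoLemma.Site d)} {L w : ℕ} {B : Finset (B1Eq324BenfattoLemma.Site d)}
    (π : ↥(Λ \ corridors L w B) → Option ↥B)
    (hπ : ∀ (y : ↥(Λ \ corridors L w B)) (m₁ : ↥B), π y = some m₁ ↔ (y : B1Eq324BenfattoLemma.Site d) ∈ shrink L (m₁ : B1Eq324BenfattoLemma.Site d) w) :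
    ∀ m₁ ∈ B, ∀ y y' : ↥(Λ \ corridors L w B),
      (y : B1Eq324BenfattoLemma.Site d) ∈ shrink L m₁ w → (y' : B1Eq324BenfattoLemma.Site d) ∈ shrink L m₁ w → π y = π y' :=
  fun m₁ hm₁ y y' hy hy' => ((hπ y ⟨m₁, hm₁⟩).mpr hy).trans ((hπ y' ⟨m₁, hm₁⟩).mpr hy').symm

/-- kernel: a `some`-iff labelling by the boxes of `B` reads `none` on the far region. [folklore] -/
private theorem labels_eq_none_of_mem_out {Λ : Finset (B1Eq324BenfattoLemma.Site d)} {L w : ℕ} {B : Finset (B1Eq324BenfattoLemma.Site d)}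
    (π : ↥(Λ \ corridors L w B) → Option ↥B)
    (hπ : ∀ (y : ↥(Λ \ corridors L w B)) (m₁ : ↥B), π y = some m₁ ↔ (y : B1Eq324BenfattoLemma.Site d) ∈ shrink L (m₁ : B1Eq324BenfattoLemma.Site d) w)
    {y : ↥(Λ \ corridors L w B)} (hy : (y : B1Eq324BenfattoLemma.Site d) ∈ out L B) : π y = none := by
  cases h : π y with
  | none => rfl
  | some m₁ => exact absurd (shrink_subset_box L (m₁ : B1Eq324BenfattoLemma.Site d) w ((hπ y m₁).mp h)) (hy m₁ m₁.2)

/-- **Separation of the parts for the labelling of record** `π : ↥(Λ ∖ Γ₁) → Option ↥B`, `π y = some m ↔ y ∈ shrink L m w` (seat n08-d's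
displayed row): sites with different labels are `≥ max(w, d(Δ_y, ⋃_{m∈B} □_m))` apart. [cite: BenfattoEtAl1978, (5.7)–(5.8) p.154–155, (5.13) p.155] -/
theorem max_le_cubeDist_of_ne {Λ : Finset (B1Eq324BenfattoLemma.Site d)} {L w : ℕ} (hL : 0 < L)
    (B : Finset (B1Eq324BenfattoLemma.Site d)) (π : ↥(Λ \ corridors L w B) → Option ↥B)
    (hπ : ∀ (y : ↥(Λ \ corridors L w B)) (m₁ : ↥B), π y = some m₁ ↔ (y : B1Eq324BenfattoLemma.Site d) ∈ shrink L (m₁ : B1Eq324BenfattoLemma.Site d) w)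
    (y y' : ↥(Λ \ corridors L w B)) (hne : π y ≠ π y') :
    max (w : ℝ) (distToRegion (B.biUnion (box L)) y) ≤
      cubeDist (y : B1Eq324BenfattoLemma.Site d) (y' : B1Eq324BenfattoLemma.Site d) :=
  max_le_cubeDist_of_ne_of_labels hL B π (labels_const_box π hπ)
    (fun _ _ hz hz' => (labels_eq_none_of_mem_out π hπ hz).trans (labels_eq_none_of_mem_out π hπ hz').symm) y y' hne

/-- kernel: the row defect of `A` restricted to `Λ ∖ Γ` is at most that of `A` (a sub-sum of non-negative terms). [folklore] -/
private theorem sum_sdiff_subtype_le {Λ Γ : Finset (B1Eq324BenfattoLemma.Site d)} {g : ↥Λ → ℝ} (hg : ∀ e, 0 ≤ g e) :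
    ∑ y' : ↥(Λ \ Γ), g ⟨y', (Finset.mem_sdiff.mp y'.2).1⟩ ≤ ∑ e : ↥Λ, g e := by
  let ι : ↥(Λ \ Γ) ↪ ↥Λ :=
    ⟨fun y' => ⟨y', (Finset.mem_sdiff.mp y'.2).1⟩, fun a b h => by
      simp only [Subtype.mk.injEq] at h
      exact Subtype.ext h⟩
  have h : ∑ y' : ↥(Λ \ Γ), g (ι y') ≤ ∑ e : ↥Λ, g e := by
    rw [← Finset.sum_map Finset.univ ι g]
    exact Finset.sum_le_univ_sum_of_nonneg hg
  exact h

/-- **THE ROW `hr` OF THE DECOUPLING THEOREMS FOR A CLASS PRECISION ACROSS THE §5 PAVEMENT.**  Let `A` on `Λ` have Combes–Thomas row defect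
`Σ_{e′}|A e e′|(cosh(κ·cubeDist e e′) − 1) ≤ J` (`κ > 0`), let `0 < L`, `0 < w`, `B` a family of tesserae, `Γ₁ = corridors L w B`, and let `π`
label `↥(Λ ∖ Γ₁)` constantly on each `shrink L m w` (`m ∈ B`) and on the far region `out L B`.  Then for every `y`,
`Σ_{π y′ ≠ π y}|A_{yy′}| ≤ J/(cosh(κ·max(w, d(Δ_y, ⋃_{m∈B} □_m))) − 1)` — the shape consumed by `…ClassDecouplingExtensive.decoupling_extensive(_conditional)`,
`…KernelComparisonBoxes` §3, `…KernelComparisonBounded` §3 and `…KernelComparisonBochner` with `r y := J/(cosh(κ·max(w, d(Δ_y, ⋃□))) − 1)`.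
[cite: BenfattoEtAl1978, §5 (5.7)–(5.8) p.154–155, (5.13) p.155 (class substitute; ours); Balaban1985BackgroundPropagators, Sect. E p.428] -/
theorem cross_rowSum_le_of_class_pavement_of_labels {Λ : Finset (B1Eq324BenfattoLemma.Site d)} {A : Matrix Λ Λ ℝ} {κ J : ℝ}
    (hκ : 0 < κ)
    (hJ : ∀ e : Λ, ∑ e' : Λ, |A e e'| *
      (Real.cosh (κ * cubeDist (e : B1Eq324BenfattoLemma.Site d) (e' : B1Eq324BenfattoLemma.Site d)) - 1) ≤ J)
    {L w : ℕ} (hL : 0 < L) (hw : 0 < w) (B : Finset (B1Eq324BenfattoLemma.Site d)) {σ : Type*} [DecidableEq σ]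
    (π : ↥(Λ \ corridors L w B) → σ)
    (hπbox : ∀ m₁ ∈ B, ∀ y y' : ↥(Λ \ corridors L w B),
      (y : B1Eq324BenfattoLemma.Site d) ∈ shrink L m₁ w → (y' : B1Eq324BenfattoLemma.Site d) ∈ shrink L m₁ w → π y = π y')
    (hπout : ∀ y y' : ↥(Λ \ corridors L w B),
      (y : B1Eq324BenfattoLemma.Site d) ∈ out L B → (y' : B1Eq324BenfattoLemma.Site d) ∈ out L B → π y = π y')
    (y : ↥(Λ \ corridors L w B)) :
    ∑ y' : ↥(Λ \ corridors L w B), (if π y = π y' then (0 : ℝ) else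
        |A ⟨y, (Finset.mem_sdiff.mp y.2).1⟩ ⟨y', (Finset.mem_sdiff.mp y'.2).1⟩|) ≤
      J / (Real.cosh (κ * max (w : ℝ) (distToRegion (B.biUnion (box L)) y)) - 1) := by
  have hJ' : ∀ z : ↥(Λ \ corridors L w B), ∑ y' : ↥(Λ \ corridors L w B),
      |A ⟨z, (Finset.mem_sdiff.mp z.2).1⟩ ⟨y', (Finset.mem_sdiff.mp y'.2).1⟩| *
        (Real.cosh (κ * cubeDist (z : B1Eq324BenfattoLemma.Site d) (y' : B1Eq324BenfattoLemma.Site d)) - 1) ≤ J := fun z =>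
    le_trans (sum_sdiff_subtype_le (g := fun e' : ↥Λ => |A ⟨z, (Finset.mem_sdiff.mp z.2).1⟩ e'| *
        (Real.cosh (κ * cubeDist (z : B1Eq324BenfattoLemma.Site d) (e' : B1Eq324BenfattoLemma.Site d)) - 1))
      fun e' => mul_nonneg (abs_nonneg _)
        (by linarith [Real.one_le_cosh (κ * cubeDist (z : B1Eq324BenfattoLemma.Site d) (e' : B1Eq324BenfattoLemma.Site d))]))
      (hJ ⟨z, (Finset.mem_sdiff.mp z.2).1⟩)
  have hw' : 0 < κ * max (w : ℝ) (distToRegion (B.biUnion (box L)) y) :=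
    mul_pos hκ (lt_of_lt_of_le (by exact_mod_cast hw) (le_max_left _ _))
  exact cross_rowSum_le_div_of_rowDefect (B := fun a b : ↥(Λ \ corridors L w B) =>
      A ⟨a, (Finset.mem_sdiff.mp a.2).1⟩ ⟨b, (Finset.mem_sdiff.mp b.2).1⟩)
    (dist := fun a b : ↥(Λ \ corridors L w B) =>
      cubeDist (a : B1Eq324BenfattoLemma.Site d) (b : B1Eq324BenfattoLemma.Site d)) π hκ.le hJ' y hw'
    fun y' hne => max_le_cubeDist_of_ne_of_labels hL B π hπbox hπout y y' hne

/-- **THE ROW `hr` FOR THE LABELLING OF RECORD** `π : ↥(Λ ∖ Γ₁) → Option ↥B`, `π y = some m ↔ y ∈ shrink L m w` (seat n08-d's displayed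
rows, verbatim those of `…KernelComparisonBounded` §3): for `A` on `Λ` with cosh row defect `J` at rate `κ > 0` w.r.t. `cubeDist`, `0 < L`, `0 < w`,
`Σ_{π y′ ≠ π y}|A_{yy′}| ≤ J/(cosh(κ·max(w, d(Δ_y, ⋃_{m∈B} □_m))) − 1)` — i.e. `hr` holds with the EXPLICIT
`r y := J/(cosh(κ·max(w, d(Δ_y, ⋃□))) − 1)`, and `hrmax` with `r_max := J/(cosh(κw) − 1)` (`crossRow_le_rmax`).
[cite: BenfattoEtAl1978, §5 (5.7)–(5.8) p.154–155, (5.13) p.155 (class substitute; ours); Balaban1985BackgroundPropagators, Sect. E p.428] -/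
theorem cross_rowSum_le_of_class_pavement {Λ : Finset (B1Eq324BenfattoLemma.Site d)} {A : Matrix Λ Λ ℝ} {κ J : ℝ} (hκ : 0 < κ)
    (hJ : ∀ e : Λ, ∑ e' : Λ, |A e e'| *
      (Real.cosh (κ * cubeDist (e : B1Eq324BenfattoLemma.Site d) (e' : B1Eq324BenfattoLemma.Site d)) - 1) ≤ J)
    {L w : ℕ} (hL : 0 < L) (hw : 0 < w) (B : Finset (B1Eq324BenfattoLemma.Site d))
    (π : ↥(Λ \ corridors L w B) → Option ↥B)
    (hπ : ∀ (y : ↥(Λ \ corridors L w B)) (m₁ : ↥B), π y = some m₁ ↔ (y : B1Eq324BenfattoLemma.Site d) ∈ shrink L (m₁ : B1Eq324BenfattoLemma.Site d) w)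
    (y : ↥(Λ \ corridors L w B)) :
    ∑ y' : ↥(Λ \ corridors L w B), (if π y = π y' then (0 : ℝ) else
        |A ⟨y, (Finset.mem_sdiff.mp y.2).1⟩ ⟨y', (Finset.mem_sdiff.mp y'.2).1⟩|) ≤
      J / (Real.cosh (κ * max (w : ℝ) (distToRegion (B.biUnion (box L)) y)) - 1) :=
  cross_rowSum_le_of_class_pavement_of_labels hκ hJ hL hw B π (labels_const_box π hπ)
    (fun _ _ hz hz' => (labels_eq_none_of_mem_out π hπ hz).trans (labels_eq_none_of_mem_out π hπ hz').symm) y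

/-- **The row ceiling `r_max`**: `J/(cosh(κ·max(w, d)) − 1) ≤ J/(cosh(κw) − 1)` for `d ≥ 0` — so the decoupling theorems' `hrmax` row holds with
`r_max := J/(cosh(κw) − 1)`, and their guard reads `J/(cosh(κw) − 1) < γ`. [cite: BenfattoEtAl1978, §5 (5.13) p.155 (class substitute; ours)] -/
theorem crossRow_le_rmax {κ J : ℝ} (hκ : 0 < κ) (hJ : 0 ≤ J) {w : ℕ} (hw : 0 < w) {D : ℝ} :
    J / (Real.cosh (κ * max (w : ℝ) D) - 1) ≤ J / (Real.cosh (κ * w) - 1) :=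
  div_cosh_sub_one_anti hJ hκ.le (mul_pos hκ (by exact_mod_cast hw)) (le_max_left _ _)

end Pavement

/-! ## §3  The budget `Σ_y r_y`: |B|·L^d-extensive and exponentially small in the corridor width -/

section Budget

/-- kernel: `e^{−c·d(Δ_y, I)} ≤ Σ_{x∈I} e^{−c·cubeDist y x}` for `I` non-empty (the infimum is attained). [folklore] -/
private theorem exp_neg_mul_distToRegion_le_sum {I : Finset (B1Eq324BenfattoLemma.Site d)} (hI : I.Nonempty) (c : ℝ)
    (y : B1Eq324BenfattoLemma.Site d) :
    Real.exp (-(c * distToRegion I y)) ≤ ∑ x ∈ I, Real.exp (-(c * cubeDist y x)) := by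
  obtain ⟨x, hx, hxeq⟩ := Finset.exists_mem_eq_inf' hI (cubeDist y)
  have hd : distToRegion I y = cubeDist y x := by rw [distToRegion, dif_pos hI, hxeq]
  rw [hd]
  exact Finset.single_le_sum (f := fun x => Real.exp (-(c * cubeDist y x))) (fun _ _ => (Real.exp_pos _).le) hx

/-- kernel: `e^{−κ·max(w, D)} ≤ e^{−κw/2}·e^{−(κ/2)·D}` for `κ ≥ 0`. [folklore] -/
private theorem exp_neg_mul_max_le {κ w D : ℝ} (hκ : 0 ≤ κ) :
    Real.exp (-(κ * max w D)) ≤ Real.exp (-(κ * w / 2)) * Real.exp (-(κ / 2 * D)) := by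
  rw [← Real.exp_add, Real.exp_le_exp]
  have h1 : w ≤ max w D := le_max_left _ _
  have h2 : D ≤ max w D := le_max_right _ _
  nlinarith

/-- kernel: the pavement `⋃_{m∈B} □_m` has at most `|B|·L^d` sites. [folklore] -/
private theorem card_biUnion_box_le (L : ℕ) (B : Finset (B1Eq324BenfattoLemma.Site d)) :
    ((B.biUnion (box L)).card : ℝ) ≤ (B.card : ℝ) * (L : ℝ) ^ d := by
  have h1 : (B.biUnion (box L)).card ≤ ∑ m₁ ∈ B, (box L m₁).card := Finset.card_biUnion_le
  have h2 : ∑ m₁ ∈ B, (box L m₁).card ≤ ∑ _m₁ ∈ B, L ^ d :=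
    Finset.sum_le_sum fun m₁ _ => by simpa only [shrink_zero] using card_shrink_le L m₁ 0
  have h3 : ∑ _m₁ ∈ B, L ^ d = B.card * L ^ d := by rw [Finset.sum_const, smul_eq_mul]
  exact_mod_cast h1.trans (h2.trans h3.le)

/-- **THE CROSS-MASS BUDGET OF THE §5 PAVEMENT.**  With `r y := J/(cosh(κ·max(w, d(Δ_y, ⋃_{m∈B} □_m))) − 1)` as in
`cross_rowSum_le_of_class_pavement` (`κ > 0`, `0 < w`, `0 ≤ J`, `B` non-empty):
`Σ_{y ∈ Λ∖Γ₁} r_y ≤ (2J/(1 − e^{−κw})²)·e^{−κw/2}·(|B|·L^d)·V_d(κ/2)`, `V_d(c) = (2e^{c/√d}/(1 − e^{−c/√d}))^d` the growth constant of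
`…ConnLength.sum_exp_neg_mul_cubeDist_le`: each `r_y ≤ (2J/(1 − e^{−κw})²)e^{−κ·max(w,d_y)} ≤ (…)e^{−κw/2}e^{−(κ/2)d_y}`, `e^{−(κ/2)d_y} ≤ Σ_{x∈⋃□}e^{−(κ/2)cubeDist y x}`,
and the double sum is `≤ |⋃□|·V_d(κ/2)` — a budget extensive in the NUMBER OF BOXES (print's «only the boxes near I carry a Hamiltonian»), not in
`|Λ|`, and exponentially small in the corridor width `w`; it is the numerator of the decoupling prefactor's `ρ = (Σ_y r_y)/(γ − r_max)`.
[cite: BenfattoEtAl1978, §5 (5.7)–(5.8) p.154–155, (5.11) p.155, (5.13) p.155 (class substitute; ours)] -/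
theorem sum_crossRow_le_of_class_pavement {Λ : Finset (B1Eq324BenfattoLemma.Site d)} {κ J : ℝ} (hκ : 0 < κ) (hJ : 0 ≤ J)
    {L w : ℕ} (hL : 0 < L) (hw : 0 < w) {B : Finset (B1Eq324BenfattoLemma.Site d)} (hB : B.Nonempty) :
    ∑ y : ↥(Λ \ corridors L w B), J / (Real.cosh (κ * max (w : ℝ) (distToRegion (B.biUnion (box L)) y)) - 1) ≤
      2 * J / (1 - Real.exp (-(κ * w))) ^ 2 * Real.exp (-(κ * w / 2)) * ((B.card : ℝ) * (L : ℝ) ^ d) *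
        (2 / (1 - Real.exp (-(κ / 2 / Real.sqrt d))) * Real.exp (κ / 2 / Real.sqrt d)) ^ d := by
  -- abbreviations (local, no definitions)
  set P : Finset (B1Eq324BenfattoLemma.Site d) := B.biUnion (box L) with hP
  set V : ℝ := (2 / (1 - Real.exp (-(κ / 2 / Real.sqrt d))) * Real.exp (κ / 2 / Real.sqrt d)) ^ d with hV
  set C : ℝ := 2 * J / (1 - Real.exp (-(κ * w))) ^ 2 with hC
  have hw' : (0 : ℝ) < w := by exact_mod_cast hw
  have hκw : 0 < κ * w := mul_pos hκ hw'
  have hC0 : 0 ≤ C := by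
    rw [hC]
    exact div_nonneg (by positivity) (sq_nonneg _)
  have hPne : P.Nonempty := by
    obtain ⟨m₁, hm₁⟩ := hB
    refine ⟨fun i => m₁ i * (L : ℤ), Finset.mem_biUnion.mpr ⟨m₁, hm₁, ?_⟩⟩
    rw [mem_box_iff]
    intro i
    have hL' : (0 : ℤ) < L := by exact_mod_cast hL
    exact ⟨le_rfl, by linarith⟩
  -- Step 1: each term in exponential form
  have hterm : ∀ y : ↥(Λ \ corridors L w B),
      J / (Real.cosh (κ * max (w : ℝ) (distToRegion P y)) - 1) ≤
        C * Real.exp (-(κ * w / 2)) * ∑ x ∈ P, Real.exp (-(κ / 2 * cubeDist (y : B1Eq324BenfattoLemma.Site d) x)) := by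
    intro y
    have hmax : (w : ℝ) ≤ max (w : ℝ) (distToRegion P y) := le_max_left _ _
    have h1 : (Real.cosh (κ * max (w : ℝ) (distToRegion P y)) - 1)⁻¹ ≤
        2 / (1 - Real.exp (-(κ * w))) ^ 2 * Real.exp (-(κ * max (w : ℝ) (distToRegion P y))) :=
      inv_cosh_sub_one_le_exp hκw (mul_le_mul_of_nonneg_left hmax hκ.le)
    have h2 : Real.exp (-(κ * max (w : ℝ) (distToRegion P y))) ≤
        Real.exp (-(κ * w / 2)) * Real.exp (-(κ / 2 * distToRegion P y)) := exp_neg_mul_max_le hκ.le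
    have h3 : Real.exp (-(κ / 2 * distToRegion P y)) ≤
        ∑ x ∈ P, Real.exp (-(κ / 2 * cubeDist (y : B1Eq324BenfattoLemma.Site d) x)) :=
      exp_neg_mul_distToRegion_le_sum hPne (κ / 2) y
    have h20 : 0 ≤ 2 / (1 - Real.exp (-(κ * w))) ^ 2 := by positivity
    calc J / (Real.cosh (κ * max (w : ℝ) (distToRegion P y)) - 1)
        = J * (Real.cosh (κ * max (w : ℝ) (distToRegion P y)) - 1)⁻¹ := div_eq_mul_inv _ _
      _ ≤ J * (2 / (1 - Real.exp (-(κ * w))) ^ 2 * Real.exp (-(κ * max (w : ℝ) (distToRegion P y)))) :=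
          mul_le_mul_of_nonneg_left h1 hJ
      _ ≤ J * (2 / (1 - Real.exp (-(κ * w))) ^ 2 * (Real.exp (-(κ * w / 2)) * Real.exp (-(κ / 2 * distToRegion P y)))) :=
          mul_le_mul_of_nonneg_left (mul_le_mul_of_nonneg_left h2 h20) hJ
      _ ≤ J * (2 / (1 - Real.exp (-(κ * w))) ^ 2 * (Real.exp (-(κ * w / 2)) *
            ∑ x ∈ P, Real.exp (-(κ / 2 * cubeDist (y : B1Eq324BenfattoLemma.Site d) x)))) :=
          mul_le_mul_of_nonneg_left (mul_le_mul_of_nonneg_left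
            (mul_le_mul_of_nonneg_left h3 (Real.exp_pos _).le) h20) hJ
      _ = C * Real.exp (-(κ * w / 2)) * ∑ x ∈ P, Real.exp (-(κ / 2 * cubeDist (y : B1Eq324BenfattoLemma.Site d) x)) := by
          rw [hC]; ring
  -- Step 2: the double sum, swapped, is at most `|P|·V`
  have hswap : ∑ y : ↥(Λ \ corridors L w B), ∑ x ∈ P, Real.exp (-(κ / 2 * cubeDist (y : B1Eq324BenfattoLemma.Site d) x)) ≤
      (P.card : ℝ) * V := by
    rw [Finset.sum_comm]
    calc ∑ x ∈ P, ∑ y : ↥(Λ \ corridors L w B), Real.exp (-(κ / 2 * cubeDist (y : B1Eq324BenfattoLemma.Site d) x))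
        ≤ ∑ _x ∈ P, V := Finset.sum_le_sum fun x _ => by
          have h := sum_exp_neg_mul_cubeDist_le (half_pos hκ) (Λ \ corridors L w B) x
          rw [← Finset.sum_coe_sort (Λ \ corridors L w B)] at h
          refine le_trans (le_of_eq (Finset.sum_congr rfl fun y _ => ?_)) h
          rw [cubeDist_comm]
      _ = (P.card : ℝ) * V := by rw [Finset.sum_const, nsmul_eq_mul]
  -- Step 3: assemble
  have hE0 : 0 ≤ C * Real.exp (-(κ * w / 2)) := mul_nonneg hC0 (Real.exp_pos _).le
  have hV0 : 0 ≤ V := by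
    rw [hV]
    have hq : 0 ≤ κ / 2 / Real.sqrt d := div_nonneg (half_pos hκ).le (Real.sqrt_nonneg _)
    have hb : 0 ≤ 1 - Real.exp (-(κ / 2 / Real.sqrt d)) := by
      linarith [Real.exp_le_one_iff.mpr (neg_nonpos.mpr hq)]
    exact pow_nonneg (mul_nonneg (div_nonneg zero_le_two hb) (Real.exp_pos _).le) d
  calc ∑ y : ↥(Λ \ corridors L w B), J / (Real.cosh (κ * max (w : ℝ) (distToRegion P y)) - 1)
      ≤ ∑ y : ↥(Λ \ corridors L w B), C * Real.exp (-(κ * w / 2)) *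
          ∑ x ∈ P, Real.exp (-(κ / 2 * cubeDist (y : B1Eq324BenfattoLemma.Site d) x)) := Finset.sum_le_sum fun y _ => hterm y
    _ = C * Real.exp (-(κ * w / 2)) *
          ∑ y : ↥(Λ \ corridors L w B), ∑ x ∈ P, Real.exp (-(κ / 2 * cubeDist (y : B1Eq324BenfattoLemma.Site d) x)) := by
        rw [Finset.mul_sum]
    _ ≤ C * Real.exp (-(κ * w / 2)) * ((P.card : ℝ) * V) := mul_le_mul_of_nonneg_left hswap hE0
    _ ≤ C * Real.exp (-(κ * w / 2)) * (((B.card : ℝ) * (L : ℝ) ^ d) * V) :=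
        mul_le_mul_of_nonneg_left (mul_le_mul_of_nonneg_right (card_biUnion_box_le L B) hV0) hE0
    _ = C * Real.exp (-(κ * w / 2)) * ((B.card : ℝ) * (L : ℝ) ^ d) * V := by ring

end Budget

end Literature.MathematicalPhysics.QuantumFieldTheory.Balaban1983to89.B1Eq324BenfattoClassCrossRowMass
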